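import Literature.Probability.Percolation.FourArmPivotalBoundary
import Literature.Probability.Percolation.LandedAltFourArm
import HarnessLib

/-!
# Pivotal sites of the four-arm event near the INNER boundary `∂Λ_{r₀}`: the painted-interior cut-point lemma and the mixed pair (proofs only)

Topic `Literature/Probability/Percolation`; family `crit-perc`. PROOFS ONLY (no definition, no
named fact). The mirror image, at the inner boundary of the annulus, of `FourArmBoundaryCut.lean`
(which treats the pivotal sites of the tree's order-free four-arm event
`armEvent ![T,F,T,F] r₀ N = O₂ ∩ C₂` near the OUTER boundary `∂Λ_N`). It serves the estimate of the
pivotal sum `Σ_v P_t(v pivotal for armEvent ![T,F,T,F] n N)` UNIFORMLY IN THE INNER RADIUS `n`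
(P. Nolin, *Near-critical percolation in two dimensions*, EJP 13 (2008), §6.2, proof of Thm. 27,
Case 1, "`v` close to `∂S_n`": arms near a boundary are half-plane arms, §4.6; W. Werner, PCMI 2009,
Lecture 6, §5: "the contributions … of those `x`'s that are close to the origin … do not matter"),
which the tree so far has for a fixed inner radius only (`FourArmPivotalSum{Bulk,Layer}.lean`).

In the situation of the Menger cut (`exists_cut_of_pivotal_plus`: an open arm `o₁ ∋ v` of
`ω ∪ {v}` from `∂Λ_{r₀}` to `∂Λ_N` and a defect `P ∉ o₁` lying on every open arm of `ω ∖ {v}`):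

* `exists_cut_of_pivotal_plus_mem` — the cut for every `v` of the CLOSED annulus
  `r₀ ≤ |v|_𝕋 ≤ N` (the proof of `exists_cut_of_pivotal_plus` verbatim; only `r₀ ≤ N` is used);
* `exists_pathIn_inward` — a lattice path from a site `z` to the origin all of whose other sites
  have graph norm `< |z|_𝕋` (iterating `exists_adj_triNorm_eq_sub_one`);
* `paintIn_shift_diff_mem_armEvent_of_cut` — for `1 ≤ r₀`, `1 ≤ D`, `r₀ ≤ |v|_𝕋`, `2D ≤ |v|_𝕋`,
  `|v|_𝕋 + 2D ≤ N`: the translate to `v` of `(ω ∖ {P}) ∪ {|·|_𝕋 < r₀}` (defect closed, the open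
  hexagon `Λ°_{r₀}` painted open) has four alternating arms from `∂Λ₁` to `∂Λ_D` — the cut-point
  lemma in the box `v + [-D, D]²`, which may stick into `Λ_{r₀}`: the outward half of `o₁` and its
  inward half prolonged through the paint down to the origin cannot be joined inside the box by an
  open path of the painted configuration avoiding `v`, since read in `ω` from its last exit from
  `Λ°_{r₀}` such a junction would be an open arm of `ω ∖ {v}` avoiding `P`;
* `shiftIn_mem_domArmEvent_mixed_of_cut` — hence, for `1 ≤ d₂`, `d₂ + 1 ≤ D`, `ω - v` has an open
  and a closed arm from `∂Λ_{d₂}` to `∂Λ_D` inside the domain `{w | r₀ ≤ |w + v|_𝕋, |w|_𝕋 ≤ D}` (the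
  closed exterior of `Λ°_{r₀}`, recentred, cut to the box): of the two closed arms of the painted configuration at most one
  passes through `P - v`, the other is a genuine closed arm of `ω` outside `Λ°_{r₀}`; the open arm is
  cut out of the OUTWARD half of `o₁`;
* `shiftIn_mem_domArmEvent_mixed_of_isPivotal` — the same for a pivotal `v`, both cases (colour flip).

## References

* P. Nolin, Near-critical percolation in two dimensions, *Electron. J. Probab.* 13 (2008), §4.6
  (arms in a half-plane), §6.2, proof of Thm. 27, Cases 1 and 3 [arXiv 0711.4948: Thm. 26]
  [Nolin2008].
* W. Werner, *Lectures on two-dimensional critical percolation*, IAS/Park City Math. Ser. 16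
  (2009), Lecture 6, §5 and proof of Lemma 6.2 (boundary contributions) [WernerPCMI2009].
* H. Kesten, Scaling relations for 2D-percolation, *Comm. Math. Phys.* 109 (1987), Lemma 8
  [KestenScalingCMP1987].
* R. Diestel, *Graph Theory*, 5th ed. (2017), Thm. 3.3.1 (Menger) [Diestel2017].

Tree: `exists_cut_of_pivotal_plus`, `armEvent_four_eq_inter` (`FourArmPivotalCut.lean`),
`paint_shift_diff_mem_armEvent_of_cut`, `shift_mem_domArmEvent_mixed_of_cut`
(`FourArmBoundaryCut.lean`, the outer-boundary originals), `armEvent_of_cutPoint`, `triSqBox`,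
`triNorm_add_le`, `triNorm_le_abs_add_abs` (`CutPointArms.lean`), `exists_adj_triNorm_eq_sub_one`
(`LandedAltFourArm.lean`), `domArmEvent`, `mem_domArmEvent_of_pathIn`, `compl_preimage_domArmEvent`,
`not_mixed_eq_comp_swap`, `domArmEvent_comp_equiv` (`HalfPlaneArmEvents.lean`,
`OneArmBoundaryArmsMixed.lean`), `PathIn` API, `triShiftIso`, `SiteConfig.relabel`,
`Literature.Combinatorics.SimpleGraph.exists_mem_support_forall` (`MengerTwo.lean`).
-/

noncomputable section

open MeasureTheory Set

namespace Literature.Probability.Percolation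

open LatticeModels Literature.Combinatorics.SimpleGraph

/-! ### The Menger defect on the closed annulus -/

/-- `exists_cut_of_pivotal_plus` for every `v` with `r₀ ≤ |v|_𝕋 ≤ N` (only `r₀ ≤ N` is used by
the proof, which is verbatim that of `FourArmPivotalCut.exists_cut_of_pivotal_plus`). [cite: Nolin2008, §6.2, proof of Thm. 27, Case 3 (arXiv 0711.4948: Thm. 26)] [cite: Diestel2017, Thm. 3.3.1 and Cor. 3.3.5 (Menger, k = 2)] -/
theorem exists_cut_of_pivotal_plus_mem {r₀ N : ℕ} {v : Site 2} {ω : SiteConfig (Site 2)}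
    (hrN : r₀ ≤ N)
    (hplus : insert v ω ∈ armEvent ![true, false, true, false] r₀ N)
    (hminus : ω \ {v} ∉ armEvent ![true, false, true, false] r₀ N) :
    ∃ (x₁ y₁ x₂ y₂ P : Site 2) (o₁ : triGraph.Walk x₁ y₁) (o₂ : triGraph.Walk x₂ y₂),
      triNorm x₁ = r₀ ∧ triNorm y₁ = N ∧ triNorm x₂ = r₀ ∧ triNorm y₂ = N ∧
      o₁.IsPath ∧ o₂.IsPath ∧
      (∀ z ∈ o₁.support, (r₀ : ℤ) ≤ triNorm z ∧ triNorm z ≤ N) ∧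
      (∀ z ∈ o₂.support, (r₀ : ℤ) ≤ triNorm z ∧ triNorm z ≤ N) ∧
      v ∈ o₁.support ∧ (∀ z ∈ o₁.support, z ≠ v → z ∈ ω) ∧
      (∀ z ∈ o₂.support, z ∈ ω ∧ z ≠ v) ∧ (∀ z ∈ o₁.support, z ∉ o₂.support) ∧
      P ∈ o₂.support ∧
      ∀ (s t : Site 2) (q : triGraph.Walk s t), triNorm s = r₀ → triNorm t = N →
        (∀ z ∈ q.support, ((r₀ : ℤ) ≤ triNorm z ∧ triNorm z ≤ N) ∧ z ∈ ω ∧ z ≠ v) →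
        P ∈ q.support := by
  classical
  rw [armEvent_four_eq_inter] at hplus hminus
  obtain ⟨hO, hC⟩ := hplus
  -- the closed arms survive the closing of `v`
  have hC' : ω \ {v} ∈ armEvent (fun _ : Fin 2 => false) r₀ N :=
    isLowerSet_armEvent (fun _ => rfl) r₀ N
      (show ω \ {v} ≤ insert v ω from fun z hz => mem_insert_of_mem _ hz.1) hC
  have hO' : ω \ {v} ∉ armEvent (fun _ : Fin 2 => true) r₀ N := fun h => hminus ⟨h, hC'⟩
  obtain ⟨x, y, w, hw, hdisj⟩ := hO
  -- the admissible set: open sites of `ω ∖ {v}` in the closed annulus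
  obtain ⟨A, hA⟩ : ∃ A : Set (Site 2), ∀ z, z ∈ A ↔
      ((r₀ : ℤ) ≤ triNorm z ∧ triNorm z ≤ N) ∧ z ∈ ω ∧ z ≠ v := ⟨{z | _}, fun _ => Iff.rfl⟩
  have hann : ∀ j, ∀ z ∈ (w j).support, (r₀ : ℤ) ≤ triNorm z ∧ triNorm z ≤ N := fun j z hz =>
    mem_triAnnulus.1 (mem_triAnnulus_of_arm hrN ((hw j).2.2.2.1 z hz))
  have hcol : ∀ j, ∀ z ∈ (w j).support, z ∈ insert v ω := fun j z hz => by
    simpa using (hw j).2.2.2.2 z hz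
  -- `v` lies on one of the two open arms
  have hv : ∃ i, v ∈ (w i).support := by
    by_contra hcon
    push Not at hcon
    refine hO' ⟨x, y, w, fun j => ?_, hdisj⟩
    obtain ⟨hx, hy, hp, hs, -⟩ := hw j
    refine ⟨hx, hy, hp, hs, fun z hz => ?_⟩
    have hzv : z ≠ v := fun h => hcon j (h ▸ hz)
    have hzω : z ∈ ω := (mem_insert_iff.1 (hcol j z hz)).resolve_left hzv
    simp [hzω, hzv]
  obtain ⟨i, hvi⟩ := hv
  obtain ⟨j, hji⟩ : ∃ j : Fin 2, j ≠ i := by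
    fin_cases i
    · exact ⟨1, by decide⟩
    · exact ⟨0, by decide⟩
  have hdisj12 : ∀ z ∈ (w i).support, z ∉ (w j).support := fun z hz hz' =>
    Finset.disjoint_left.1 (hdisj hji.symm) (List.mem_toFinset.2 hz) (List.mem_toFinset.2 hz')
  have hvj : v ∉ (w j).support := hdisj12 v hvi
  have ho₂A : ∀ z ∈ (w j).support, z ∈ A := fun z hz =>
    (hA z).2 ⟨hann j z hz, (mem_insert_iff.1 (hcol j z hz)).resolve_left (fun h => hvj (h ▸ hz)),
      fun h => hvj (h ▸ hz)⟩
  -- Menger's theorem for two paths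
  have hone : ∃ (s t : Site 2) (q : triGraph.Walk s t), s ∈ (↑(triSphere r₀) : Set (Site 2)) ∧
      t ∈ (↑(triSphere N) : Set (Site 2)) ∧ ∀ z ∈ q.support, z ∈ A :=
    ⟨x j, y j, w j, (hw j).1, (hw j).2.1, ho₂A⟩
  have htwo : ¬ ∃ (s₁ t₁ s₂ t₂ : Site 2) (p₁ : triGraph.Walk s₁ t₁) (p₂ : triGraph.Walk s₂ t₂),
      s₁ ∈ (↑(triSphere r₀) : Set (Site 2)) ∧ t₁ ∈ (↑(triSphere N) : Set (Site 2)) ∧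
      s₂ ∈ (↑(triSphere r₀) : Set (Site 2)) ∧ t₂ ∈ (↑(triSphere N) : Set (Site 2)) ∧
      p₁.IsPath ∧ p₂.IsPath ∧ (∀ z ∈ p₁.support, z ∈ A) ∧ (∀ z ∈ p₂.support, z ∈ A) ∧
      ∀ z ∈ p₁.support, z ∉ p₂.support := by
    rintro ⟨s₁, t₁, s₂, t₂, p₁, p₂, hs₁, ht₁, hs₂, ht₂, -, -, hp₁A, hp₂A, hdj⟩
    obtain ⟨T, hT⟩ : ∃ T : Fin 2 → Set (Site 2),
        T 0 = {z | z ∈ p₁.support} ∧ T 1 = {z | z ∈ p₂.support} :=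
      ⟨![{z | z ∈ p₁.support}, {z | z ∈ p₂.support}], rfl, rfl⟩
    refine hO' (mem_armEvent_of_pathIn (fun _ : Fin 2 => true) T ?_ ?_ ?_ ?_)
    · intro a b hab
      fin_cases a <;> fin_cases b
      · exact absurd rfl hab
      · change Disjoint (T 0) (T 1)
        rw [hT.1, hT.2]; exact Set.disjoint_left.2 fun z hz hz' => hdj z hz hz'
      · change Disjoint (T 1) (T 0)
        rw [hT.1, hT.2]; exact Set.disjoint_left.2 fun z hz hz' => hdj z hz' hz
      · exact absurd rfl hab
    · intro a z hz
      fin_cases a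
      · change z ∈ T 0 at hz
        rw [hT.1] at hz
        obtain ⟨-, h2, h3⟩ := (hA z).1 (hp₁A z hz)
        simp [h2, h3]
      · change z ∈ T 1 at hz
        rw [hT.2] at hz
        obtain ⟨-, h2, h3⟩ := (hA z).1 (hp₂A z hz)
        simp [h2, h3]
    · intro a z hz
      fin_cases a
      · change z ∈ T 0 at hz
        rw [hT.1] at hz; exact ((hA z).1 (hp₁A z hz)).1
      · change z ∈ T 1 at hz
        rw [hT.2] at hz; exact ((hA z).1 (hp₂A z hz)).1
    · intro a
      fin_cases a
      · refine ⟨s₁, hs₁, t₁, ht₁, ?_⟩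
        change PathIn triGraph (T 0) s₁ t₁
        rw [hT.1]; exact PathIn.of_walk p₁ fun z hz => hz
      · refine ⟨s₂, hs₂, t₂, ht₂, ?_⟩
        change PathIn triGraph (T 1) s₂ t₂
        rw [hT.2]; exact PathIn.of_walk p₂ fun z hz => hz
  obtain ⟨P, hPA, hPall⟩ :=
    Literature.Combinatorics.SimpleGraph.exists_mem_support_forall hone htwo
  have hPo₂ : P ∈ (w j).support := hPall _ _ (w j) (hw j).1 (hw j).2.1 ho₂A
  refine ⟨x i, y i, x j, y j, P, w i, w j, mem_triSphere_iff.1 (hw i).1,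
    mem_triSphere_iff.1 (hw i).2.1, mem_triSphere_iff.1 (hw j).1, mem_triSphere_iff.1 (hw j).2.1,
    (hw i).2.2.1, (hw j).2.2.1, hann i, hann j, hvi,
    fun z hz hzv => (mem_insert_iff.1 (hcol i z hz)).resolve_left hzv,
    fun z hz => ⟨((hA z).1 (ho₂A z hz)).2.1, ((hA z).1 (ho₂A z hz)).2.2⟩, hdisj12, hPo₂,
    fun s t q hs ht hq => hPall s t q (mem_triSphere_iff.2 hs) (mem_triSphere_iff.2 ht)
      fun z hz => (hA z).2 (hq z hz)⟩

/-! ### An inward lattice path -/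

/-- **A path from `z` down to the origin through sites of norm `< |z|_𝕋`**: there is a `𝕋`-path
from `z` to `0` inside `{z} ∪ {w | |w|_𝕋 < |z|_𝕋}` (iterate `exists_adj_triNorm_eq_sub_one`).
[folklore] -/
theorem exists_pathIn_inward (z : Site 2) :
    PathIn triGraph ({z} ∪ {w | triNorm w < triNorm z}) z 0 := by
  suffices key : ∀ (m : ℕ) (z : Site 2), triNorm z ≤ m →
      PathIn triGraph ({z} ∪ {w | triNorm w < triNorm z}) z 0 by
    exact key (triNorm z).toNat z (Int.self_le_toNat _)
  intro m
  induction m with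
  | zero =>
    intro z hz
    by_cases hz0 : z = 0
    · subst hz0
      exact PathIn.refl (show (0 : Site 2) ∈ ({0} ∪ {w | triNorm w < triNorm (0 : Site 2)} :
        Set (Site 2)) from Or.inl (mem_singleton _))
    · obtain ⟨z', -, hn'⟩ := exists_adj_triNorm_eq_sub_one hz0
      have := triNorm_nonneg z'
      push_cast at hz
      omega
  | succ m ih =>
    intro z hz
    by_cases hz0 : z = 0
    · subst hz0
      exact PathIn.refl (show (0 : Site 2) ∈ ({0} ∪ {w | triNorm w < triNorm (0 : Site 2)} :
        Set (Site 2)) from Or.inl (mem_singleton _))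
    · obtain ⟨z', hzz', hn'⟩ := exists_adj_triNorm_eq_sub_one hz0
      have hp := ih z' (by push_cast at hz ⊢; omega)
      have hzS : z ∈ ({z} ∪ {w | triNorm w < triNorm z} : Set (Site 2)) := Or.inl (mem_singleton _)
      have hz'S : z' ∈ ({z} ∪ {w | triNorm w < triNorm z} : Set (Site 2)) := by
        right; show triNorm z' < triNorm z; omega
      refine (PathIn.of_adj hzS hz'S hzz').trans (hp.mono ?_)
      rintro w (hw | hw)
      · rw [mem_singleton_iff] at hw
        right; show triNorm w < triNorm z; rw [hw]; omega
      · right; show triNorm w < triNorm z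
        change triNorm w < triNorm z' at hw; omega

/-! ### The painted-interior cut-point lemma -/

section Painted

variable {r₀ N D : ℕ} {v P x₁ y₁ : Site 2} {ω : SiteConfig (Site 2)}

/-- **The painted-interior cut-point lemma at a pivotal site of `O₂` near the inner boundary**
(see the module docstring; mirror image of `paint_shift_diff_mem_armEvent_of_cut`). [cite: Nolin2008, §6.2, proof of Thm. 27, Cases 1 and 3, and §4.6 (arXiv 0711.4948: Thm. 26)] [cite: WernerPCMI2009, Lecture 6, §5 and proof of Lemma 6.2 (boundary contributions)] -/
theorem paintIn_shift_diff_mem_armEvent_of_cut (o₁ : triGraph.Walk x₁ y₁) (hr₀ : 1 ≤ r₀) (hD : 1 ≤ D)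
    (hvr : (r₀ : ℤ) ≤ triNorm v) (hv2 : 2 * (D : ℤ) ≤ triNorm v) (hvN : triNorm v + 2 * D ≤ N)
    (hx₁ : triNorm x₁ = r₀) (hy₁ : triNorm y₁ = N)
    (ho₁ann : ∀ z ∈ o₁.support, (r₀ : ℤ) ≤ triNorm z ∧ triNorm z ≤ N)
    (ho₁ω : ∀ z ∈ o₁.support, z ≠ v → z ∈ ω) (hPo₁ : P ∉ o₁.support)
    (hcut : ∀ (s t : Site 2) (q : triGraph.Walk s t), triNorm s = r₀ → triNorm t = N →
      (∀ z ∈ q.support, ((r₀ : ℤ) ≤ triNorm z ∧ triNorm z ≤ N) ∧ z ∈ ω ∧ z ≠ v) →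
      P ∈ q.support) :
    SiteConfig.relabel (triShiftIso (-v)).toEquiv ((ω \ {P}) ∪ {z | triNorm z < r₀}) ∈
      armEvent ![true, false, true, false] 1 D := by
  classical
  have hD0 : (0 : ℤ) ≤ D := by positivity
  set Int : Set (Site 2) := {z | triNorm z < r₀} with hInt
  have hIntmem : ∀ {z : Site 2}, z ∈ Int ↔ triNorm z < r₀ := fun {z} => Iff.rfl
  set ωp : SiteConfig (Site 2) := (ω \ {P}) ∪ Int with hωp
  -- admissible sites off `v` and `P` (role of `A'`), and the sites of the open walk (role of `B`)
  obtain ⟨A', hA'⟩ : ∃ A' : Set (Site 2), ∀ z, z ∈ A' ↔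
      ((r₀ : ℤ) ≤ triNorm z ∧ triNorm z ≤ N) ∧ z ∈ ω ∧ z ≠ v ∧ z ≠ P := ⟨{z | _}, fun _ => Iff.rfl⟩
  obtain ⟨B, hB⟩ : ∃ B : Set (Site 2), ∀ z, z ∈ B ↔
      ((r₀ : ℤ) ≤ triNorm z ∧ triNorm z ≤ N) ∧ (z = v ∨ (z ∈ ω ∧ z ≠ P)) :=
    ⟨{z | _}, fun _ => Iff.rfl⟩
  have hγ : PathIn triGraph B x₁ y₁ := PathIn.of_walk o₁ fun z hz => (hB z).2 ⟨ho₁ann z hz, by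
    by_cases hzv : z = v
    · exact Or.inl hzv
    · exact Or.inr ⟨ho₁ω z hz hzv, fun h => hPo₁ (h ▸ hz)⟩⟩
  set A : Set (Site 2) := B \ {v} with hAdef
  have hAmem : ∀ z, z ∈ A ↔ ((r₀ : ℤ) ≤ triNorm z ∧ triNorm z ≤ N) ∧ z ∈ ω ∧ z ≠ P ∧ z ≠ v := by
    intro z
    rw [hAdef, mem_sdiff, mem_singleton_iff, hB]
    constructor
    · rintro ⟨⟨h1, h2⟩, hzv⟩
      exact ⟨h1, (h2.resolve_left hzv).1, (h2.resolve_left hzv).2, hzv⟩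
    · rintro ⟨h1, h2, h3, h4⟩
      exact ⟨⟨h1, Or.inr ⟨h2, h3⟩⟩, h4⟩
  have hAsub : A ⊆ A' := fun z hz => by
    obtain ⟨h1, h2, h3, h4⟩ := (hAmem z).1 hz
    exact (hA' z).2 ⟨h1, h2, h4, h3⟩
  set Bset : Set (Site 2) := A' ∪ Int with hBset
  have hA'B : A' ⊆ Bset := subset_union_left
  have hvInt : v ∉ Int := fun h => by rw [hIntmem] at h; omega
  -- `Bset ⊆ ωp ∖ {v}` and its sites have norm `≤ N`
  have hBωp : Bset ⊆ ωp \ {v} := by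
    rintro z (hz | hz)
    · obtain ⟨-, hzω, hzv, hzP⟩ := (hA' z).1 hz
      exact ⟨Or.inl ⟨hzω, by rwa [mem_singleton_iff]⟩, by rwa [mem_singleton_iff]⟩
    · exact ⟨Or.inr hz, fun h => hvInt (by rw [mem_singleton_iff] at h; rwa [h] at hz)⟩
  have hBnorm : ∀ z ∈ Bset, triNorm z ≤ N := by
    rintro z (hz | hz)
    · exact ((hA' z).1 hz).1.2
    · rw [hIntmem] at hz; omega
  have hy₁v : y₁ ≠ v := by intro h; rw [h] at hy₁; omega
  -- no admissible path from `x₁` to `y₁`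
  have hnot : ¬ PathIn triGraph A' x₁ y₁ := by
    intro hp
    obtain ⟨W, hW⟩ := hp.exists_walk
    have hPW := hcut x₁ y₁ W hx₁ hy₁ fun z hz => by
      obtain ⟨h1, h2, h3, -⟩ := (hA' z).1 (hW z hz); exact ⟨h1, h2, h3⟩
    exact ((hA' P).1 (hW P hPW)).2.2.2 rfl
  -- the open walk passes through `v`
  rcases hγ.split_at v with havoid | ⟨hP', hS'⟩
  · exact (hnot (havoid.mono hAsub)).elim
  obtain ⟨b₁, hb₁v, hsuf⟩ := hS'.resolve_left hy₁v
  -- the inward half-path, prolonged through the paint down to the origin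
  have hv0 : v ≠ 0 := by
    intro h; rw [h, triNorm_zero] at hvr; omega
  have hin : ∃ a₁, triGraph.Adj a₁ v ∧ PathIn triGraph Bset a₁ 0 := by
    by_cases hxv : x₁ = v
    · -- the arm starts at `v ∈ ∂Λ_{r₀}`: go straight in from `v`
      obtain ⟨a₁, hva₁, hna₁⟩ := exists_adj_triNorm_eq_sub_one hv0
      have hvn : triNorm v = r₀ := by rw [← hxv]; exact hx₁
      refine ⟨a₁, hva₁.symm, (exists_pathIn_inward a₁).mono ?_⟩
      rintro w (hw | hw)
      · rw [mem_singleton_iff] at hw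
        right; rw [hIntmem, hw]; omega
      · right; rw [hIntmem]; change triNorm w < triNorm a₁ at hw; omega
    · obtain ⟨a₁, ha₁v, hpre⟩ := hP'.resolve_left hxv
      refine ⟨a₁, ha₁v, (hpre.symm.mono (hAsub.trans hA'B)).trans ?_⟩
      have hxA' : x₁ ∈ A' := hAsub ⟨hγ.left_mem, by rw [mem_singleton_iff]; exact hxv⟩
      refine (exists_pathIn_inward x₁).mono ?_
      rintro w (hw | hw)
      · rw [mem_singleton_iff] at hw
        rw [hw]; exact hA'B hxA'
      · right; rw [hIntmem]; change triNorm w < triNorm x₁ at hw; omega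
  obtain ⟨a₁, ha₁v, hαB⟩ := hin
  have hβB : PathIn triGraph Bset b₁ y₁ := hsuf.symm.mono (hAsub.trans hA'B)
  -- translate by `-v`
  set φ := triShiftIso (-v) with hφ
  have hφapp : ∀ w, φ w = w - v := fun w => by simp [hφ, sub_eq_add_neg]
  have himage : ∀ (T : Set (Site 2)) (w : Site 2), w ∈ φ '' T ↔ w + v ∈ T := by
    intro T w
    constructor
    · rintro ⟨w', hw', rfl⟩; rw [hφapp]; simpa using hw'
    · intro hw; exact ⟨w + v, hw, by rw [hφapp]; simp⟩
  set ξ : SiteConfig (Site 2) := SiteConfig.relabel φ.toEquiv ωp with hξ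
  have hmemξ : ∀ w, w ∈ ξ ↔ w + v ∈ ωp := by
    intro w
    rw [hξ, SiteConfig.mem_relabel_iff]
    have : φ.toEquiv.symm w = w + v := by
      apply φ.toEquiv.injective
      rw [Equiv.apply_symm_apply]
      show w = φ (w + v)
      rw [hφapp]; simp
    rw [this]
  have hadj : ∀ {w : Site 2}, triGraph.Adj w v → triGraph.Adj (φ w) 0 := by
    intro w hw
    have := φ.map_adj_iff.2 hw
    rwa [show φ v = 0 by rw [hφapp, sub_self]] at this
  set U : Set (Site 2) := φ '' Bset with hU
  have hUξ : ∀ w ∈ U, w ∈ ξ ∧ w ≠ 0 := by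
    intro w hw
    rw [hU, himage] at hw
    obtain ⟨hw1, hw2⟩ := hBωp hw
    refine ⟨(hmemξ w).2 hw1, fun h => hw2 ?_⟩
    rw [mem_singleton_iff, h, zero_add]
  have hα₀ : PathIn triGraph U (φ a₁) (φ 0) := pathIn_map_iso φ hαB
  have hβ₀ : PathIn triGraph U (φ b₁) (φ y₁) := pathIn_map_iso φ hβB
  -- the interior of the box; the far endpoints lie outside it
  set R : Set (Site 2) := {z | |z 0| < D ∧ |z 1| < D} with hR
  have hRmem : ∀ {z : Site 2}, z ∈ R ↔ |z 0| < D ∧ |z 1| < D := fun {z} => Iff.rfl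
  have hfar : ∀ {w : Site 2}, 2 * (D : ℤ) ≤ triNorm w → w ∉ R := by
    intro w hw hwR
    obtain ⟨h0, h1⟩ := hwR
    have := triNorm_le_abs_add_abs w
    omega
  have hφ0far : φ 0 ∉ R := by
    apply hfar
    rw [hφapp, zero_sub, triNorm_neg]
    exact hv2
  have hφy₁far : φ y₁ ∉ R := by
    apply hfar
    rw [hφapp]
    have h1 := triNorm_add_le (y₁ - v) v
    rw [sub_add_cancel] at h1
    omega
  -- stopping a half-path on the boundary of the box, with a tight support
  have stop : ∀ {u₁ e' : Site 2}, triGraph.Adj u₁ 0 → e' ∉ R → PathIn triGraph U u₁ e' →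
      ∃ (S : Set (Site 2)) (c : Site 2), S ⊆ triSqBox D ∩ U ∧ PathIn triGraph S u₁ c ∧
        (|c 0| = D ∨ |c 1| = D) ∧ ∀ z ∈ S, PathIn triGraph U u₁ z := by
    intro u₁ e' hu₁ he' hp
    have hu₁1 : triNorm u₁ = 1 := by
      have := triNorm_sub_eq_one_of_adj hu₁; rwa [sub_zero] at this
    obtain ⟨hu0', hu1', -⟩ := abs_le_triNorm u₁
    by_cases huR : u₁ ∈ R
    · obtain ⟨p, q, hpR, hqR, hqA, hpq, hpath⟩ := hp.exit huR he'
      have hpath' : PathIn triGraph (insert q (R ∩ U)) u₁ q :=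
        (hpath.mono fun z hz => mem_insert_of_mem _ hz).tail hpq (mem_insert q _)
      obtain ⟨S, hS, hSp, hall⟩ := hpath'.exists_support
      have hq : q ∈ triSqBox D ∧ (|q 0| = D ∨ |q 1| = D) := by
        rw [hRmem, abs_lt, abs_lt] at hpR
        rw [hRmem, not_and_or, not_lt, not_lt, le_abs, le_abs] at hqR
        rw [triGraph_adj_iff_coord] at hpq
        rw [mem_triSqBox, abs_le, abs_le, abs_eq hD0, abs_eq hD0]
        omega
      have hSsub : S ⊆ triSqBox D ∩ U := by
        intro z hz
        rcases hS hz with h | ⟨hzR, hzA⟩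
        · rw [h]; exact ⟨hq.1, hqA⟩
        · rw [hRmem, abs_lt, abs_lt] at hzR
          exact ⟨by rw [mem_triSqBox, abs_le, abs_le]; omega, hzA⟩
      exact ⟨S, q, hSsub, hSp, hq.2, fun z hz => (hall z hz).mono fun w hw => (hSsub hw).2⟩
    · refine ⟨{u₁}, u₁, ?_, PathIn.refl (mem_singleton u₁), ?_, ?_⟩
      · intro z hz
        rw [mem_singleton_iff] at hz
        rw [hz]
        exact ⟨by rw [mem_triSqBox]; constructor <;> omega, hp.left_mem⟩
      · rw [hRmem, not_and_or, not_lt, not_lt] at huR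
        rcases huR with h | h
        · left; omega
        · right; omega
      · intro z hz
        rw [mem_singleton_iff] at hz
        rw [hz]
        exact PathIn.refl hp.left_mem
  obtain ⟨Sα, a, hSα, hα, had, hallα⟩ := stop (hadj ha₁v) hφ0far hα₀
  obtain ⟨Sβ, b, hSβ, hβ, hbd, hallβ⟩ := stop (hadj hb₁v) hφy₁far hβ₀
  have hSα' : Sα ⊆ (triSqBox D \ {0}) ∩ ξ := fun z hz =>
    ⟨⟨(hSα hz).1, (hUξ z (hSα hz).2).2⟩, (hUξ z (hSα hz).2).1⟩
  have hSβ' : Sβ ⊆ (triSqBox D \ {0}) ∩ ξ := fun z hz =>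
    ⟨⟨(hSβ hz).1, (hUξ z (hSβ hz).2).2⟩, (hUξ z (hSβ hz).2).1⟩
  refine armEvent_of_cutPoint hD hSα' hSβ' (hadj ha₁v) (hadj hb₁v) hα hβ had hbd ?_
  -- the cut-point hypothesis: an open junction, read in `ω` from `∂Λ_{r₀}` on, would avoid `v`, `P`
  intro z hz z' hz' hp
  have W : PathIn triGraph (U ∪ (triSqBox D \ {0}) ∩ ξ) (φ 0) (φ y₁) :=
    (((hα₀.symm.trans (hallα z hz)).mono subset_union_left).trans
      (hp.mono subset_union_right)).trans (((hallβ z' hz').symm.trans hβ₀).mono subset_union_left)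
  have hback := pathIn_map_iso (triShiftIso v) W
  have e1 : ∀ w, triShiftIso v (φ w) = w := fun w => by rw [triShiftIso_apply, hφapp]; abel
  rw [e1, e1] at hback
  -- the sites of the joined path: in `ωp ∖ {v}` and of norm `≤ N`
  have hset : (triShiftIso v) '' (U ∪ (triSqBox D \ {0}) ∩ ξ) ⊆ (ωp \ {v}) ∩ {w | triNorm w ≤ N} := by
    rintro _ ⟨w, hw, rfl⟩
    rw [triShiftIso_apply]
    rcases hw with hw | ⟨⟨hw1, hw0⟩, hwξ⟩
    · rw [hU, himage] at hw; exact ⟨hBωp hw, hBnorm _ hw⟩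
    · refine ⟨⟨(hmemξ w).1 hwξ, fun h => hw0 ?_⟩, ?_⟩
      · rw [mem_singleton_iff] at h ⊢
        have : w + v = 0 + v := by rw [zero_add]; exact h
        exact add_right_cancel this
      · show triNorm (w + v) ≤ N
        have h2 := triNorm_le_abs_add_abs w
        have h3 := triNorm_add_le w v
        rw [mem_triSqBox] at hw1
        omega
  have W' : PathIn triGraph ((ωp \ {v}) ∩ {w | triNorm w ≤ N}) 0 y₁ := hback.mono hset
  -- last exit from `Λ°_{r₀}`
  set C : Set (Site 2) := {w | triNorm w < r₀} with hC
  have h0C : (0 : Site 2) ∈ C := by show triNorm (0 : Site 2) < r₀; rw [triNorm_zero]; omega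
  have hy₁C : y₁ ∉ C := by show ¬ triNorm y₁ < r₀; omega
  obtain ⟨p, q, hpC, -, hqC, hpq, hpath⟩ := W'.last_exit h0C hy₁C
  change triNorm p < r₀ at hpC
  change ¬ triNorm q < r₀ at hqC
  have hqr : triNorm q = r₀ := le_antisymm (by
    have := triNorm_le_triNorm_add_one_of_adj hpq; omega) (not_lt.1 hqC)
  -- the final segment is an admissible path from `q` to `y₁` avoiding `P`
  have hpath' : PathIn triGraph A' q y₁ := by
    refine hpath.mono ?_
    rintro w ⟨⟨⟨hwω, hwv⟩, hwΛ⟩, hwC⟩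
    change triNorm w ≤ N at hwΛ
    change ¬ triNorm w < r₀ at hwC
    rw [mem_singleton_iff] at hwv
    rcases hwω with ⟨hw1, hw2⟩ | hw
    · rw [mem_singleton_iff] at hw2
      exact (hA' w).2 ⟨⟨not_lt.1 hwC, hwΛ⟩, hw1, hwv, hw2⟩
    · rw [hIntmem] at hw; exact absurd hw hwC
  obtain ⟨W₂, hW₂⟩ := hpath'.exists_walk
  have hPW := hcut q y₁ W₂ hqr hy₁ fun w hw => by
    obtain ⟨h1, h2, h3, -⟩ := (hA' w).1 (hW₂ w hw); exact ⟨h1, h2, h3⟩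
  exact ((hA' P).1 (hW₂ P hPW)).2.2.2 rfl

/-- **The mixed pair near the inner boundary** (see the module docstring; mirror image of
`shift_mem_domArmEvent_mixed_of_cut`): in the situation of `exists_cut_of_pivotal_plus_mem`, for
`1 ≤ r₀ ≤ |v|_𝕋`, `1 ≤ D`, `2D ≤ |v|_𝕋`, `|v|_𝕋 + 2D ≤ N`, `1 ≤ d₂`, `d₂ + 1 ≤ D`, the translate
`ω - v` has an open and a closed arm from `∂Λ_{d₂}` to `∂Λ_D` inside
`{w | r₀ ≤ |w + v|_𝕋, |w|_𝕋 ≤ D}`, whatever the position of the defect `P`. [cite: Nolin2008, §4.6 and §6.2, proof of Thm. 27, Cases 1 and 3 (arXiv 0711.4948: Thm. 26)] [cite: WernerPCMI2009, Lecture 6, §5 and proof of Lemma 6.2 (boundary contributions)] -/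
theorem shiftIn_mem_domArmEvent_mixed_of_cut (o₁ : triGraph.Walk x₁ y₁) (hr₀ : 1 ≤ r₀) (hD : 1 ≤ D)
    (hvr : (r₀ : ℤ) ≤ triNorm v) (hv2 : 2 * (D : ℤ) ≤ triNorm v) (hvN : triNorm v + 2 * D ≤ N)
    (hx₁ : triNorm x₁ = r₀) (hy₁ : triNorm y₁ = N)
    (ho₁ann : ∀ z ∈ o₁.support, (r₀ : ℤ) ≤ triNorm z ∧ triNorm z ≤ N)
    (hvo₁ : v ∈ o₁.support) (ho₁ω : ∀ z ∈ o₁.support, z ≠ v → z ∈ ω) (hPo₁ : P ∉ o₁.support)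
    (hcut : ∀ (s t : Site 2) (q : triGraph.Walk s t), triNorm s = r₀ → triNorm t = N →
      (∀ z ∈ q.support, ((r₀ : ℤ) ≤ triNorm z ∧ triNorm z ≤ N) ∧ z ∈ ω ∧ z ≠ v) →
      P ∈ q.support)
    {d₂ : ℕ} (hd₂ : 1 ≤ d₂) (hd₂D : d₂ + 1 ≤ D) :
    SiteConfig.relabel (triShiftIso (-v)).toEquiv ω ∈
      domArmEvent ![true, false] d₂ D {w | (r₀ : ℤ) ≤ triNorm (w + v) ∧ triNorm w ≤ D} := by
  classical
  set φ := triShiftIso (-v) with hφ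
  have hφapp : ∀ z, φ z = z - v := fun z => by simp [hφ, sub_eq_add_neg]
  have himage : ∀ (T : Set (Site 2)) (z : Site 2), z ∈ φ '' T ↔ z + v ∈ T := by
    intro T z
    constructor
    · rintro ⟨z', hz', rfl⟩; rw [hφapp]; simpa using hz'
    · intro hz; exact ⟨z + v, hz, by rw [hφapp]; simp⟩
  have hsymm : ∀ z : Site 2, φ.toEquiv.symm z = z + v := by
    intro z
    apply φ.toEquiv.injective
    rw [Equiv.apply_symm_apply]
    show z = φ (z + v)
    rw [hφapp]; simp
  have hmemω : ∀ z, z ∈ SiteConfig.relabel φ.toEquiv ω ↔ z + v ∈ ω := by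
    intro z; rw [SiteConfig.mem_relabel_iff, hsymm]
  -- the two closed arms of the painted configuration, from `∂Λ_{d₂}`; one of them avoids `P - v`
  have h4 := paintIn_shift_diff_mem_armEvent_of_cut o₁ hr₀ hD hvr hv2 hvN hx₁ hy₁ ho₁ann ho₁ω hPo₁
    hcut
  have he : Function.Injective (![1, 3] : Fin 2 → Fin 4) := by decide
  have h2 := armEvent_mono_left _ hd₂ (by omega) (armEvent_subset_armEvent_comp _ 1 D he h4)
  have hκ : ((![true, false, true, false] : Fin 4 → Bool) ∘ (![1, 3] : Fin 2 → Fin 4)) =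
      ![false, false] := by
    ext i; fin_cases i <;> rfl
  rw [hκ] at h2
  obtain ⟨x, y, w, hw, hdisj⟩ := h2
  obtain ⟨j, hjP⟩ : ∃ j : Fin 2, P - v ∉ (w j).support := by
    by_contra hcon
    push Not at hcon
    have h01 := Finset.disjoint_left.1 (hdisj (show (0 : Fin 2) ≠ 1 by decide))
      (List.mem_toFinset.2 (hcon 0)) (List.mem_toFinset.2 (hcon 1))
    exact h01
  obtain ⟨hx0, hy0, -, hsupp0, hcol0⟩ := hw j
  have hclosed : ∀ z ∈ (w j).support,
      ((d₂ : ℤ) ≤ triNorm z ∧ triNorm z ≤ D) ∧ (r₀ : ℤ) ≤ triNorm (z + v) ∧ z + v ∉ ω := by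
    intro z hz
    have hzann := mem_triAnnulus.1 (mem_triAnnulus_of_arm (by omega) (hsupp0 z hz))
    have hc := hcol0 z hz
    have hjc : (![false, false] : Fin 2 → Bool) j = false := by fin_cases j <;> rfl
    rw [hjc] at hc
    have hc' : z ∉ SiteConfig.relabel φ.toEquiv ((ω \ {P}) ∪ {z | triNorm z < r₀}) :=
      fun h => Bool.false_ne_true (hc.1 h)
    rw [SiteConfig.mem_relabel_iff, hsymm] at hc'
    have hc2 : (r₀ : ℤ) ≤ triNorm (z + v) := by
      by_contra hlt
      push Not at hlt
      exact hc' (Or.inr hlt)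
    have hzP : z + v ≠ P := by
      intro h; apply hjP; rw [show P - v = z by rw [← h, add_sub_cancel_right]]; exact hz
    refine ⟨hzann, hc2, fun hzω => hc' (Or.inl ⟨hzω, ?_⟩)⟩
    rw [mem_singleton_iff]; exact hzP
  -- the open outward half of `o₁`: from a neighbour of `v` to `y₁`, outside `Λ°_{r₀}`, off `v`, `P`
  obtain ⟨o₁a, o₁b, ho₁⟩ := SimpleGraph.Walk.mem_support_iff_exists_append.1 hvo₁
  have ho₁b : ∀ z ∈ o₁b.support, z ∈ o₁.support := fun z hz => by
    rw [ho₁, SimpleGraph.Walk.mem_support_append_iff]; exact Or.inr hz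
  obtain ⟨Bv, hBv⟩ : ∃ Bv : Set (Site 2), ∀ z, z ∈ Bv ↔
      ((r₀ : ℤ) ≤ triNorm z ∧ triNorm z ≤ N) ∧ (z = v ∨ (z ∈ ω ∧ z ≠ P)) :=
    ⟨{z | _}, fun _ => Iff.rfl⟩
  have hγ : PathIn triGraph Bv v y₁ := PathIn.of_walk o₁b fun z hz => (hBv z).2
    ⟨ho₁ann z (ho₁b z hz), by
      by_cases hzv : z = v
      · exact Or.inl hzv
      · exact Or.inr ⟨ho₁ω z (ho₁b z hz) hzv, fun h => hPo₁ (h ▸ ho₁b z hz)⟩⟩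
  have hy₁v : y₁ ≠ v := by intro h; rw [h] at hy₁; omega
  obtain ⟨b₁, hb₁, hsuf⟩ : ∃ b₁, triGraph.Adj b₁ v ∧ PathIn triGraph (Bv \ {v}) y₁ b₁ := by
    rcases hγ.split_at v with havoid | ⟨-, hS'⟩
    · exact absurd havoid.left_mem (fun h => h.2 (mem_singleton v))
    · exact hS'.resolve_left hy₁v
  set Sv : Set (Site 2) := Bv \ {v} with hSv
  have hSmem : ∀ z, z ∈ φ '' Sv → (r₀ : ℤ) ≤ triNorm (z + v) ∧ z + v ∈ ω := by
    intro z hz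
    rw [himage] at hz
    obtain ⟨hz1, hzv⟩ := hz
    rw [mem_singleton_iff] at hzv
    obtain ⟨h1, h2⟩ := (hBv _).1 hz1
    exact ⟨h1.1, (h2.resolve_left hzv).1⟩
  -- in the coordinates centred at `v`: from `b₁ - v` (norm `≤ 1`) to `y₁ - v` (norm `≥ 2D`)
  have hp0 : PathIn triGraph (φ '' Sv) (φ b₁) (φ y₁) := pathIn_map_iso φ hsuf.symm
  have hb₁n : triNorm (φ b₁) ≤ 1 := by
    have hadj' : triGraph.Adj (φ v) (φ b₁) := (φ.map_adj_iff.2 hb₁).symm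
    rw [hφapp v, sub_self] at hadj'
    have := triNorm_le_triNorm_add_one_of_adj hadj'
    rw [triNorm_zero] at this
    exact this
  have hy₁n : 2 * (D : ℤ) ≤ triNorm (φ y₁) := by
    rw [hφapp]
    have h1 := triNorm_add_le (y₁ - v) v
    rw [sub_add_cancel] at h1
    omega
  -- first visit to norm `≥ D`
  set R₂ : Set (Site 2) := {z | triNorm z < D} with hR₂
  have hxR : φ b₁ ∈ R₂ := by show triNorm (φ b₁) < D; omega
  have hyR : φ y₁ ∉ R₂ := by show ¬ triNorm (φ y₁) < D; omega
  obtain ⟨p, q, hpR, hqR, hqS, hpq, hpath⟩ := hp0.exit hxR hyR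
  change triNorm p < D at hpR
  change ¬ triNorm q < D at hqR
  have hqn : triNorm q = D := by
    have := triNorm_le_triNorm_add_one_of_adj hpq; omega
  have hpath1 : PathIn triGraph (insert q (R₂ ∩ φ '' Sv)) (φ b₁) q :=
    (hpath.mono fun z hz => mem_insert_of_mem _ hz).tail hpq (mem_insert q _)
  -- last visit to norm `≤ d₂`
  set C : Set (Site 2) := {z | triNorm z ≤ d₂} with hC
  have hxC : φ b₁ ∈ C := by show triNorm (φ b₁) ≤ d₂; omega
  have hqC : q ∉ C := by show ¬ triNorm q ≤ d₂; omega
  obtain ⟨a, b, haC, haS, hbC, hab, hpath2⟩ := hpath1.last_exit hxC hqC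
  change triNorm a ≤ d₂ at haC
  change ¬ triNorm b ≤ d₂ at hbC
  have han : triNorm a = d₂ := by
    have := triNorm_le_triNorm_add_one_of_adj hab; omega
  set T' : Set (Site 2) := insert a (insert q (R₂ ∩ φ '' Sv) \ C) with hT'
  have hT'path : PathIn triGraph T' a q :=
    (PathIn.of_adj (mem_insert a _) (mem_insert_of_mem _ hpath2.left_mem) hab).trans
      (hpath2.mono fun z hz => mem_insert_of_mem _ hz)
  have hT'sub : ∀ z ∈ T', ((d₂ : ℤ) ≤ triNorm z ∧ triNorm z ≤ D) ∧ z ∈ φ '' Sv := by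
    intro z hz
    rcases hz with rfl | ⟨hz1, hz2⟩
    · refine ⟨⟨by omega, by omega⟩, ?_⟩
      rcases haS with h | h
      · rw [h]; exact hqS
      · exact h.2
    · change ¬ triNorm z ≤ d₂ at hz2
      rcases hz1 with rfl | ⟨hzR, hzT⟩
      · exact ⟨⟨by omega, by omega⟩, hqS⟩
      · change triNorm z < D at hzR
        exact ⟨⟨by omega, by omega⟩, hzT⟩
  -- the two site sets: open, resp. closed, sites of the annulus inside the domain
  set T₀ : Set (Site 2) := {z | ((d₂ : ℤ) ≤ triNorm z ∧ triNorm z ≤ D) ∧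
    (r₀ : ℤ) ≤ triNorm (z + v) ∧ z + v ∈ ω} with hT₀
  set T₁ : Set (Site 2) := {z | ((d₂ : ℤ) ≤ triNorm z ∧ triNorm z ≤ D) ∧
    (r₀ : ℤ) ≤ triNorm (z + v) ∧ z + v ∉ ω} with hT₁
  have hT'T₀ : T' ⊆ T₀ := fun z hz => ⟨(hT'sub z hz).1, hSmem z (hT'sub z hz).2⟩
  refine mem_domArmEvent_of_pathIn ![true, false] ![T₀, T₁] ?_ ?_ ?_ ?_ ?_
  · -- disjoint
    intro i i' hii'
    fin_cases i <;> fin_cases i'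
    · exact absurd rfl hii'
    · exact Set.disjoint_left.2 fun z (hz : z ∈ T₀) (hz' : z ∈ T₁) => hz'.2.2 hz.2.2
    · exact Set.disjoint_left.2 fun z (hz : z ∈ T₁) (hz' : z ∈ T₀) => hz.2.2 hz'.2.2
    · exact absurd rfl hii'
  · -- colours
    intro i z hz
    fin_cases i
    · change z ∈ T₀ at hz
      rw [hmemω]; simpa using hz.2.2
    · change z ∈ T₁ at hz
      rw [hmemω]; simpa using hz.2.2
  · -- annulus
    intro i z hz
    fin_cases i
    · exact (show z ∈ T₀ from hz).1
    · exact (show z ∈ T₁ from hz).1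
  · -- domain (with the size restriction `|z| ≤ D`, free from the annulus condition)
    intro i z hz
    fin_cases i
    · exact ⟨(show z ∈ T₀ from hz).2.1, (show z ∈ T₀ from hz).1.2⟩
    · exact ⟨(show z ∈ T₁ from hz).2.1, (show z ∈ T₁ from hz).1.2⟩
  · -- the two paths
    intro i
    fin_cases i
    · refine ⟨a, ?_, q, ?_, hT'path.mono hT'T₀⟩
      · rw [mem_triSphere_iff, han]
      · rw [mem_triSphere_iff, hqn]
    · refine ⟨x j, hx0, y j, hy0, PathIn.of_walk (w j) fun z hz => ?_⟩
      exact ⟨(hclosed z hz).1, (hclosed z hz).2.1, (hclosed z hz).2.2⟩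

end Painted

/-! ### Both cases at a pivotal site -/

/-- **The mixed pair at a pivotal site near the inner boundary, both cases**: if `v` is pivotal
for `armEvent ![T,F,T,F] r₀ N`, `1 ≤ r₀ ≤ |v|_𝕋`, `2D ≤ |v|_𝕋`, `|v|_𝕋 + 2D ≤ N`, `1 ≤ d₂`,
`d₂ + 1 ≤ D`, then `ω - v` has an open and a closed arm from `∂Λ_{d₂}` to `∂Λ_D` inside
`{w | r₀ ≤ |w + v|_𝕋, |w|_𝕋 ≤ D}` (Case⁺: `shiftIn_mem_domArmEvent_mixed_of_cut`; Case⁻: the same for `ωᶜ`,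
the mixed pair being colour symmetric). [cite: Nolin2008, §4.6 and §6.2, proof of Thm. 27, Cases 1 and 3 (arXiv 0711.4948: Thm. 26)] [cite: WernerPCMI2009, Lecture 6, §5 and proof of Lemma 6.2 (boundary contributions)] -/
theorem shiftIn_mem_domArmEvent_mixed_of_isPivotal {r₀ N D d₂ : ℕ} {v : Site 2} (hr₀ : 1 ≤ r₀)
    (hD : 1 ≤ D) (hvr : (r₀ : ℤ) ≤ triNorm v) (hv2 : 2 * (D : ℤ) ≤ triNorm v)
    (hvN : triNorm v + 2 * D ≤ N) {ω : SiteConfig (Site 2)}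
    (hpiv : IsPivotal (armEvent ![true, false, true, false] r₀ N) v ω) (hd₂ : 1 ≤ d₂)
    (hd₂D : d₂ + 1 ≤ D) :
    SiteConfig.relabel (triShiftIso (-v)).toEquiv ω ∈
      domArmEvent ![true, false] d₂ D {w | (r₀ : ℤ) ≤ triNorm (w + v) ∧ triNorm w ≤ D} := by
  have hrN : r₀ ≤ N := by
    have : (r₀ : ℤ) ≤ N := by omega
    exact_mod_cast this
  have key : ∀ ζ : SiteConfig (Site 2), insert v ζ ∈ armEvent ![true, false, true, false] r₀ N →
      ζ \ {v} ∉ armEvent ![true, false, true, false] r₀ N →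
      SiteConfig.relabel (triShiftIso (-v)).toEquiv ζ ∈
        domArmEvent ![true, false] d₂ D {w | (r₀ : ℤ) ≤ triNorm (w + v) ∧ triNorm w ≤ D} := by
    intro ζ hplus hminus
    obtain ⟨x₁, y₁, x₂, y₂, P, o₁, o₂, hx₁, hy₁, -, -, -, -, ho₁ann, -, hvo₁, ho₁ω, -, hdisj, hPo₂,
      hcut⟩ := exists_cut_of_pivotal_plus_mem hrN hplus hminus
    exact shiftIn_mem_domArmEvent_mixed_of_cut o₁ hr₀ hD hvr hv2 hvN hx₁ hy₁ ho₁ann hvo₁ ho₁ω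
      (fun h => hdisj P h hPo₂) hcut hd₂ hd₂D
  rcases hpiv with ⟨hplus, hminus⟩ | ⟨hminus, hplus⟩
  · exact key ω hplus hminus
  · have hins : insert v ωᶜ = (ω \ {v})ᶜ := by
      ext z; simp [mem_insert_iff]; tauto
    have hdiff : ωᶜ \ {v} = (insert v ω)ᶜ := by
      ext z; simp [mem_insert_iff]; tauto
    have hplus' : insert v ωᶜ ∈ armEvent ![true, false, true, false] r₀ N := by
      rw [hins, compl_mem_armEvent_four_iff]; exact hminus
    have hminus' : ωᶜ \ {v} ∉ armEvent ![true, false, true, false] r₀ N := by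
      rw [hdiff, compl_mem_armEvent_four_iff]; exact hplus
    have h := key ωᶜ hplus' hminus'
    rw [relabel_compl, ← Set.mem_preimage, compl_preimage_domArmEvent, not_mixed_eq_comp_swap,
      domArmEvent_comp_equiv] at h
    exact h

end Literature.Probability.Percolation
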